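import Summits.ABC.Harvest.OpenQuestionsGlue
import Literature.NumberTheory.DiophantineGeometry.AbcWave0BakerExplicitProofs
import Summits.ABC.FunctionField.TransferSheet
import HarnessLib

/-!
# ABC harvest — GLUE-BAKER: Baker's Conjecture 3 ⟹ abc; per-`η` Small Derivatives ⟹ poly-abc

`Summits/ABC/Harvest/GlueBaker.lean` — cell `abc-harv`, seat abc-harv-pr-2 (KEY GLUE-BAKER), namespace
`Summit.ABC.Harvest`. PROOF-ONLY file (no definition, no `sorry`, no axiom, no Literature fact): the three
glue arrows of the cell's glue ledger assigned to this seat (HARVEST.md §GLUE LEDGER G-17 / G-16 / G-10).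

* §1 (row H-301, G-17, rung **A0 door**) `bakerOmega_imp_abc : BakerOmegaConjecture → ABC` — Baker's
  Conjecture 3 (Publ. Math. Debrecen 65 (2004) p. 256: «`max(|a|,|b|,|c|) ≪ N((log N)/ω(ab))^{κ ω(ab)}`»,
  typed as `Summit.ABC.Harvest.BakerOmegaConjecture`, `∃ κ K`) implies the summit `_root_.ABC`. The
  elementary estimate (`exists_const_bakerOmegaFactor_le`): for every real `κ` and every `ε > 0` there is
  `D` with `((log N)/ω(ab))^{κ·ω(ab)} ≤ D · N^ε` on abc triples. For `κ > 0` this is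
  `((L/k)^k)^κ ≤ (L^k/k!)^κ ≤ (C(ε/κ) N^{ε/κ})^κ` by `k! ≤ k^k`, `ω(ab)! ≤ ω(abc)! ≤ rad(abc)` and the tree's
  `exists_const_log_pow_div_factorial_le` (the `C(ε)` machinery of Baker's Conjecture 4,
  `AbcWave0BakerExplicitProofs`); for `κ ≤ 0` the factor is `≤ 1` because `log N ≥ ω(ab)`
  (`rad(abc) ≥ 3^{ω(abc)−1} ≥ 3^{ω(ab)} ≥ e^{ω(ab)}`, as `c ≥ 2` contributes a prime); the junk case
  `ω(ab) = 0` (the triple `1 + 1 = 2`, `0^0 = 1`) is harmless. Pattern: `bakerExplicitABC_imp_abc`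
  (`Summits/ABC/StrongHypotheses.lean`).
* §2 (row H-102, G-16, rung **POLY-ABC door** — «NOT abc; NOT known ⟹ A-PS») the per-`η` form of Pasten,
  CMB 65 (2022) Lemma 4.1 «If the Small Derivative Conjecture holds for some value of `η`, then Oesterlé's
  abc Conjecture holds for every `M > 1/(1−η)`» [arXiv:2106.16165 p. 9]:
  `polyABC_of_smallDerivativesWith : 0 < η → η < 1 → SmallDerivativesConjectureWith η → 1/(1−η) < M →
  PolyABC M` (the finitely many exceptional triples are absorbed in the constant of
  `Summit.ABC.ABC.Theorems.PolyABC M`; the tree had only the `∃η ∃M` form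
  `Pasten.exists_exponent_of_smallDerivatives_holds`). Corollary `abc_of_forall_smallDerivativesWith`: the
  UNPRINTED «SDC for every `η > 0`» reading would give abc (positioning only — that hypothesis is the
  harvester's extrapolation, plausibly false for small `η`, HARVEST.md H-102 PLAN CORRECTION / REF-B).
* (row H-019, G-10, rung **A-PS → POLY-ABC**) `Summit.ABC.PolySzpiroRat → PastenWeakABC` (Pasten JNT 254
  Conj. 1.1 ⟹ Conj. 1.2) is ALREADY PROVED in the tree as `Summit.ABC.Harvest.pastenWeakABC_of_polySzpiroRat`
  (`OpenQuestionsGlueAPS.lean`, p548749, seat typ-1 landing referee REF-B's Frey-curve argument) — CITED by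
  name, not re-proved and not imported here.
* §3 (appended) `polyABC_iff_polyAbcWith : PolyABC M ↔ Summit.ABC.FunctionField.PolyAbcWith M` — currency
  bridge to the abc-ff cell's transfer sheet, recording that its `polyAbcWith_of_smallDerivativesWith`
  (p548194) and §2's `polyABC_of_smallDerivativesWith` are one arrow in two currencies.

HONESTY LINE (D-0138/D-0139/D-0140): abc is not proved by any of this — `BakerOmegaConjecture → ABC` is a
STRONGER-HYPOTHESIS arrow (an A0 door), not evidence for abc; A-PS is NOT abc — «NOT abc — POLY-SZPIRO(E)»;
poly-abc is not known to give A-PS; typed ≠ proved.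
-/

noncomputable section

open Real UniqueFactorizationMonoid
open scoped ArithmeticFunction.omega Nat

namespace Summit.ABC.Harvest

open Literature.NumberTheory.DiophantineGeometry
open Literature.Barriers.ABC

/-! ## §1 Baker's Conjecture 3 (`ω`-form) ⟹ abc (row H-301, G-17) -/

/-- `3^{ω(n) − 1} ≤ rad(n)`: all prime factors but possibly `2` are `≥ 3`. [folklore] -/
theorem three_pow_cardDistinctFactors_sub_one_le_radical (n : ℕ) :
    3 ^ (ω n - 1) ≤ radical n := by
  rw [cardDistinctFactors_eq_card_primeFactors, Nat.radical_eq_prod_primeFactors]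
  calc 3 ^ (n.primeFactors.card - 1) ≤ 3 ^ (n.primeFactors.erase 2).card :=
        Nat.pow_le_pow_right (by norm_num) Finset.pred_card_le_card_erase
    _ ≤ ∏ p ∈ n.primeFactors.erase 2, p :=
        Finset.pow_card_le_prod _ (fun p => p) 3 fun p hp => by
          obtain ⟨hp2, hp⟩ := Finset.mem_erase.mp hp
          have := (Nat.prime_of_mem_primeFactors hp).two_le
          omega
    _ ≤ ∏ p ∈ n.primeFactors, p :=
        Finset.prod_le_prod_of_subset_of_one_le' (Finset.erase_subset 2 _) fun p hp _ =>
          (Nat.prime_of_mem_primeFactors hp).one_le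

/-- For an abc triple, `ω(ab) + 1 ≤ ω(abc)`: `ab` and `c` are coprime and `c ≥ 2` has a prime factor.
[folklore] -/
theorem cardDistinctFactors_mul_succ_le {a b c : ℕ} (h : IsABCTriple a b c) :
    ω (a * b) + 1 ≤ ω (a * b * c) := by
  have h2 := h.two_le
  obtain ⟨-, -, rfl, hab⟩ := h
  have hcop : Nat.Coprime (a * b) (a + b) :=
    Nat.Coprime.mul_left (Nat.coprime_self_add_right.mpr hab) (Nat.coprime_add_self_right.mpr hab.symm)
  rw [ArithmeticFunction.cardDistinctFactors_mul hcop]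
  have : 0 < ω (a + b) := ArithmeticFunction.cardDistinctFactors_pos.mpr (by omega)
  omega

/-- For an abc triple, `ω(ab) ≤ log rad(abc)` (natural logarithm): `rad(abc) ≥ 3^{ω(abc)−1} ≥ 3^{ω(ab)}`
and `log 3 ≥ 1`. So the base `(log N)/ω(ab)` of Baker's Conjecture 3 is `≥ 1` whenever `ω(ab) ≥ 1`.
[folklore] -/
theorem cardDistinctFactors_mul_le_log_rad {a b c : ℕ} (h : IsABCTriple a b c) :
    (ω (a * b) : ℝ) ≤ Real.log ((rad a b c : ℕ) : ℝ) := by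
  have h1 : 3 ^ ω (a * b) ≤ rad a b c := by
    calc 3 ^ ω (a * b) ≤ 3 ^ (ω (a * b * c) - 1) :=
          Nat.pow_le_pow_right (by norm_num) (by have := cardDistinctFactors_mul_succ_le h; omega)
      _ ≤ radical (a * b * c) := three_pow_cardDistinctFactors_sub_one_le_radical _
      _ = rad a b c := (rad_def a b c).symm
  have h2 : (3 : ℝ) ^ ω (a * b) ≤ ((rad a b c : ℕ) : ℝ) := by exact_mod_cast h1
  have h3 : Real.log ((3 : ℝ) ^ ω (a * b)) ≤ Real.log ((rad a b c : ℕ) : ℝ) :=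
    Real.log_le_log (by positivity) h2
  rw [Real.log_pow] at h3
  have hlog3 : (1 : ℝ) ≤ Real.log 3 := by
    rw [Real.le_log_iff_exp_le (by norm_num)]
    exact Real.exp_one_lt_three.le
  calc (ω (a * b) : ℝ) = ω (a * b) * 1 := (mul_one _).symm
    _ ≤ ω (a * b) * Real.log 3 := by gcongr
    _ ≤ _ := h3

/-- For an abc triple, `ω(ab)! ≤ rad(abc)` (`ω(ab)! ≤ ω(abc)!` and the tree's
`factorial_cardDistinctFactors_le_radical`). [folklore] -/
theorem factorial_cardDistinctFactors_mul_le_rad {a b c : ℕ} (h : IsABCTriple a b c) :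
    (ω (a * b))! ≤ rad a b c := by
  have h1 : (ω (a * b))! ≤ (ω (a * b * c))! :=
    Nat.factorial_le (by have := cardDistinctFactors_mul_succ_le h; omega)
  have h2 := factorial_cardDistinctFactors_le_radical (a * b * c)
  rw [← rad_def] at h2
  exact h1.trans h2

/-- **The `ω`-factor of Baker's Conjecture 3 is sub-polynomial in `N = rad(abc)`**: for every real `κ`
and every `ε > 0` there is `D ≥ 1` with `((log N)/ω(ab))^{κ·ω(ab)} ≤ D · N^ε` for all abc triples
(`^` = `Real.rpow`). For `κ > 0`: `((L/k)^k)^κ ≤ (L^k/k!)^κ ≤ (C N^{ε/κ})^κ = C^κ N^ε` with `k = ω(ab)`,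
`L = log N`, `k! ≤ k^k`, `k! ≤ N` and `C = C(ε/κ)` of `exists_const_log_pow_div_factorial_le`; for `κ ≤ 0`
the factor is `≤ 1` (`L/k ≥ 1` by `cardDistinctFactors_mul_le_log_rad`); `k = 0` gives the factor `1`.
[cite: Baker2004, §3 (pp. 256–258)] -/
theorem exists_const_bakerOmegaFactor_le (κ ε : ℝ) (hε : 0 < ε) :
    ∃ D : ℝ, 1 ≤ D ∧ ∀ a b c : ℕ, IsABCTriple a b c →
      (Real.log ((rad a b c : ℕ) : ℝ) / (ω (a * b) : ℝ)) ^ (κ * (ω (a * b) : ℝ)) ≤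
        D * ((rad a b c : ℕ) : ℝ) ^ ε := by
  rcases le_or_gt κ 0 with hκ | hκ
  · -- `κ ≤ 0`: the factor is at most `1`
    refine ⟨1, le_rfl, fun a b c ht => ?_⟩
    have hr1 : (1 : ℝ) ≤ ((rad a b c : ℕ) : ℝ) := by
      exact_mod_cast le_trans (by norm_num) ht.two_le_rad
    have hNε : (1 : ℝ) ≤ ((rad a b c : ℕ) : ℝ) ^ ε := Real.one_le_rpow hr1 hε.le
    rw [one_mul]
    refine le_trans ?_ hNε
    rcases Nat.eq_zero_or_pos (ω (a * b)) with h0 | hpos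
    · rw [h0, Nat.cast_zero, mul_zero, Real.rpow_zero]
    · have hk0 : (0 : ℝ) < ω (a * b) := by exact_mod_cast hpos
      have hx1 : (1 : ℝ) ≤ Real.log ((rad a b c : ℕ) : ℝ) / (ω (a * b) : ℝ) := by
        rw [le_div_iff₀ hk0, one_mul]
        exact cardDistinctFactors_mul_le_log_rad ht
      exact Real.rpow_le_one_of_one_le_of_nonpos hx1 (mul_nonpos_of_nonpos_of_nonneg hκ hk0.le)
  · -- `κ > 0`: reduce to the `C(ε)` estimate of Baker's Conjecture 4
    obtain ⟨C, hC1, hC⟩ := exists_const_log_pow_div_factorial_le (ε / κ) (by positivity)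
    have hC0 : (0 : ℝ) ≤ C := by linarith
    refine ⟨C ^ κ, Real.one_le_rpow hC1 hκ.le, fun a b c ht => ?_⟩
    have hr1 : (1 : ℝ) ≤ ((rad a b c : ℕ) : ℝ) := by
      exact_mod_cast le_trans (by norm_num) ht.two_le_rad
    have hr0 : (0 : ℝ) ≤ ((rad a b c : ℕ) : ℝ) := by linarith
    have hNε : (1 : ℝ) ≤ ((rad a b c : ℕ) : ℝ) ^ ε := Real.one_le_rpow hr1 hε.le
    have hCκ0 : (0 : ℝ) ≤ C ^ κ := Real.rpow_nonneg hC0 κ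
    have hL0 : 0 ≤ Real.log ((rad a b c : ℕ) : ℝ) := Real.log_nonneg hr1
    rcases Nat.eq_zero_or_pos (ω (a * b)) with h0 | hpos
    · rw [h0, Nat.cast_zero, mul_zero, Real.rpow_zero]
      calc (1 : ℝ) ≤ C ^ κ := Real.one_le_rpow hC1 hκ.le
        _ ≤ C ^ κ * ((rad a b c : ℕ) : ℝ) ^ ε := le_mul_of_one_le_right hCκ0 hNε
    · have hk0 : (0 : ℝ) < ω (a * b) := by exact_mod_cast hpos
      have hx0 : 0 ≤ Real.log ((rad a b c : ℕ) : ℝ) / (ω (a * b) : ℝ) := div_nonneg hL0 hk0.le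
      have hfac : (((ω (a * b))! : ℕ) : ℝ) ≤ ((rad a b c : ℕ) : ℝ) := by
        exact_mod_cast factorial_cardDistinctFactors_mul_le_rad ht
      have hmain : (Real.log ((rad a b c : ℕ) : ℝ) / (ω (a * b) : ℝ)) ^ ω (a * b) ≤
          C * ((rad a b c : ℕ) : ℝ) ^ (ε / κ) := by
        calc (Real.log ((rad a b c : ℕ) : ℝ) / (ω (a * b) : ℝ)) ^ ω (a * b)
            = Real.log ((rad a b c : ℕ) : ℝ) ^ ω (a * b) / (ω (a * b) : ℝ) ^ ω (a * b) :=
              div_pow _ _ _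
          _ ≤ Real.log ((rad a b c : ℕ) : ℝ) ^ ω (a * b) / (ω (a * b))! := by
              apply div_le_div_of_nonneg_left (pow_nonneg hL0 _) (by positivity)
              exact_mod_cast Nat.factorial_le_pow (ω (a * b))
          _ ≤ C * ((rad a b c : ℕ) : ℝ) ^ (ε / κ) := hC (ω (a * b)) _ hr1 hfac
      calc (Real.log ((rad a b c : ℕ) : ℝ) / (ω (a * b) : ℝ)) ^ (κ * (ω (a * b) : ℝ))
          = ((Real.log ((rad a b c : ℕ) : ℝ) / (ω (a * b) : ℝ)) ^ ω (a * b)) ^ κ := by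
            rw [mul_comm κ (ω (a * b) : ℝ), Real.rpow_mul hx0, Real.rpow_natCast]
        _ ≤ (C * ((rad a b c : ℕ) : ℝ) ^ (ε / κ)) ^ κ :=
            Real.rpow_le_rpow (pow_nonneg hx0 _) hmain hκ.le
        _ = C ^ κ * (((rad a b c : ℕ) : ℝ) ^ (ε / κ)) ^ κ :=
            Real.mul_rpow hC0 (Real.rpow_nonneg hr0 _)
        _ = C ^ κ * ((rad a b c : ℕ) : ℝ) ^ ε := by
            rw [← Real.rpow_mul hr0, div_mul_cancel₀ ε hκ.ne']

/-- **GLUE (PROVED), row H-301 / G-17: Baker's Conjecture 3 (2004, `ω`-form) ⟹ the abc conjecture**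
(the summit statement `_root_.ABC`): from `c ≤ K · N · ((log N)/ω(ab))^{κ·ω(ab)}` and
`exists_const_bakerOmegaFactor_le`, `c ≤ |K| · D(κ,ε) · N^{1+ε} < (|K| D + 1) N^{1+ε}` for every `ε > 0`.
Baker: Conjecture 3 is the refinement of the Oesterlé–Masser conjecture his Ξ-programme targets; like
Conjecture 4 (`bakerExplicitABC_imp_abc`) it is at least as strong as abc, so it is used only as a
hypothesis (A0 DOOR; abc is not proved by this). [cite: Baker2004, Conj. 3 (p. 256) and §3 (pp. 257–258)] -/
theorem bakerOmega_imp_abc : BakerOmegaConjecture → _root_.ABC := by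
  rintro ⟨κ, K, h⟩
  refine ABC_iff.mpr fun ε hε => ?_
  obtain ⟨D, hD1, hD⟩ := exists_const_bakerOmegaFactor_le κ ε hε
  have hD0 : 0 ≤ D := le_trans zero_le_one hD1
  refine ⟨|K| * D + 1, by positivity, fun a b c ht => ?_⟩
  have hB := h a b c ht
  have hF := hD a b c ht
  have hr1 : (1 : ℝ) ≤ ((rad a b c : ℕ) : ℝ) := by
    exact_mod_cast le_trans (by norm_num) ht.two_le_rad
  have hr0 : (0 : ℝ) < ((rad a b c : ℕ) : ℝ) := by linarith
  have hF0 : 0 ≤ (Real.log ((rad a b c : ℕ) : ℝ) / (ω (a * b) : ℝ)) ^ (κ * (ω (a * b) : ℝ)) :=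
    Real.rpow_nonneg (div_nonneg (Real.log_nonneg hr1) (Nat.cast_nonneg _)) _
  have h1 : (c : ℝ) ≤ |K| * ((rad a b c : ℕ) : ℝ) *
      (Real.log ((rad a b c : ℕ) : ℝ) / (ω (a * b) : ℝ)) ^ (κ * (ω (a * b) : ℝ)) :=
    hB.trans (mul_le_mul_of_nonneg_right (mul_le_mul_of_nonneg_right (le_abs_self K) hr0.le) hF0)
  have h2 : |K| * ((rad a b c : ℕ) : ℝ) *
      (Real.log ((rad a b c : ℕ) : ℝ) / (ω (a * b) : ℝ)) ^ (κ * (ω (a * b) : ℝ)) ≤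
      |K| * ((rad a b c : ℕ) : ℝ) * (D * ((rad a b c : ℕ) : ℝ) ^ ε) :=
    mul_le_mul_of_nonneg_left hF (by positivity)
  have h3 : |K| * ((rad a b c : ℕ) : ℝ) * (D * ((rad a b c : ℕ) : ℝ) ^ ε) =
      |K| * D * ((rad a b c : ℕ) : ℝ) ^ (1 + ε) := by
    rw [Real.rpow_add hr0, Real.rpow_one]; ring
  have hpow : 0 < ((rad a b c : ℕ) : ℝ) ^ (1 + ε) := Real.rpow_pos_of_pos hr0 _
  have h4 : (|K| * D + 1) * ((rad a b c : ℕ) : ℝ) ^ (1 + ε) =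
      |K| * D * ((rad a b c : ℕ) : ℝ) ^ (1 + ε) + ((rad a b c : ℕ) : ℝ) ^ (1 + ε) := by ring
  calc (c : ℝ) ≤ |K| * D * ((rad a b c : ℕ) : ℝ) ^ (1 + ε) := by rw [← h3]; exact h1.trans h2
    _ < (|K| * D + 1) * ((rad a b c : ℕ) : ℝ) ^ (1 + ε) := by rw [h4]; linarith

/-! ## §2 Per-`η` Small Derivatives ⟹ poly-abc with every exponent `M > 1/(1−η)` (row H-102, G-16) -/

/-- **GLUE (PROVED), row H-102 / G-16: Pasten's Lemma 4.1 per exponent.** If the Small Derivatives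
Conjecture holds with exponent `0 < η < 1` (`Pasten.SmallDerivativesConjectureWith η`, CMB 65 (2022)
Conj. 3.9), then the polynomial abc inequality `c ≤ C · rad(abc)^M` (`Summit.ABC.ABC.Theorems.PolyABC M`)
holds for EVERY `M > 1/(1 − η)`. Proof as printed: the excluded triples `(1, N, q)` have `c < rad(abc)`
(`Pasten.lt_rad_of_isExcludedTriple`; `(1,1,2)` has `c = rad`); outside the finite exceptional set
Theorem 3.3 (`Pasten.abc_estimate_holds`) with `‖ψ‖ < c^η` gives `c/log c ≤ rad(abc) c^η/log 2`, and with
`log c ≤ c^δ/δ`, `δ = 1 − η − 1/M > 0`, this is `c^{1/M} ≤ rad(abc)/(δ log 2)`, i.e.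
`c ≤ (δ log 2)^{−M} rad(abc)^M`; the finitely many exceptional triples have `c ≤ C₀`. The constant is
`max (max C₀ 1) ((1/(δ log 2))^M)`. STRENGTH: a POLY-ABC door («NOT abc; NOT known ⟹ A-PS»).
[cite: Pasten2021, Lemma 4.1 (arXiv p. 9), Thm. 3.3, Conj. 3.9] -/
theorem polyABC_of_smallDerivativesWith {η : ℝ} (hη0 : 0 < η) (hη1 : η < 1)
    (h : Pasten.SmallDerivativesConjectureWith η) {M : ℝ} (hM : 1 / (1 - η) < M) :
    Summit.ABC.ABC.Theorems.PolyABC M := by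
  set S : Set (ℕ × ℕ × ℕ) := {t : ℕ × ℕ × ℕ | IsABCTriple t.1 t.2.1 t.2.2 ∧
      ¬ Pasten.IsExcludedTriple t.1 t.2.1 t.2.2 ∧
      ¬ ∃ ψ : ℕ → ℤ, Pasten.IsAdapted ψ t.1 t.2.1 ∧ Pasten.wronskian ψ t.1 t.2.1 ≠ 0 ∧
          ∀ p : ℕ, (|ψ p| : ℝ) < (t.2.2 : ℝ) ^ η} with hS
  have hfin : S.Finite := h
  -- a bound for `c` on the finite exceptional set
  obtain ⟨C₀, hC₀⟩ : ∃ C₀ : ℕ, ∀ t ∈ S, t.2.2 ≤ C₀ :=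
    ⟨hfin.toFinset.sup fun t => t.2.2, fun t ht =>
      Finset.le_sup (f := fun t : ℕ × ℕ × ℕ => t.2.2) (hfin.mem_toFinset.mpr ht)⟩
  -- constants
  have hlog2 : 0 < Real.log 2 := Real.log_pos one_lt_two
  have h1η : 0 < 1 - η := by linarith
  have hM1 : 1 < M := by
    have : (1 : ℝ) ≤ 1 / (1 - η) := by
      rw [le_div_iff₀ h1η]; linarith
    linarith
  have hM0 : 0 < M := by linarith
  obtain ⟨δ, hδ⟩ : ∃ δ : ℝ, δ = 1 - η - 1 / M := ⟨_, rfl⟩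
  have hδ0 : 0 < δ := by
    have h1 : 1 < M * (1 - η) := by rwa [div_lt_iff₀ h1η] at hM
    have h2 : 1 / M < 1 - η := by
      rw [div_lt_iff₀ hM0]; linarith
    rw [hδ]; linarith
  obtain ⟨K, hK⟩ : ∃ K : ℝ, K = 1 / (δ * Real.log 2) := ⟨_, rfl⟩
  have hK0 : 0 < K := by rw [hK]; positivity
  set Cst : ℝ := max (max (C₀ : ℝ) 1) (K ^ M) with hCst
  have hCst1 : 1 ≤ Cst := le_max_of_le_left (le_max_right _ _)
  have hCst0 : 0 < Cst := lt_of_lt_of_le one_pos hCst1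
  refine ⟨Cst, hCst0, fun a b c habc => ?_⟩
  have hR2 : (2 : ℝ) ≤ ((rad a b c : ℕ) : ℝ) := by exact_mod_cast habc.two_le_rad
  have hR1 : (1 : ℝ) ≤ ((rad a b c : ℕ) : ℝ) := by linarith
  have hRM1 : (1 : ℝ) ≤ ((rad a b c : ℕ) : ℝ) ^ M := Real.one_le_rpow hR1 hM0.le
  have hc2 : 2 ≤ c := habc.two_le
  by_cases hmem : (a, b, c) ∈ S
  · -- exceptional triple: `c ≤ C₀ ≤ Cst ≤ Cst · rad^M`
    have h1 : c ≤ C₀ := hC₀ _ hmem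
    calc (c : ℝ) ≤ C₀ := by exact_mod_cast h1
      _ ≤ Cst := le_max_of_le_left (le_max_left _ _)
      _ ≤ Cst * ((rad a b c : ℕ) : ℝ) ^ M := le_mul_of_one_le_right hCst0.le hRM1
  by_cases hex : Pasten.IsExcludedTriple a b c
  · -- excluded triple: `c ≤ rad(abc) ≤ rad^M`
    have hcR : (c : ℝ) ≤ ((rad a b c : ℕ) : ℝ) := by
      by_cases h11 : (a, b) = (1, 1)
      · obtain ⟨rfl, rfl⟩ := Prod.mk.inj h11
        have hc : c = 2 := by obtain ⟨-, -, hs, -⟩ := habc; omega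
        subst hc
        exact_mod_cast habc.two_le_rad
      · exact_mod_cast (Pasten.lt_rad_of_isExcludedTriple habc hex h11).le
    calc (c : ℝ) ≤ ((rad a b c : ℕ) : ℝ) := hcR
      _ = ((rad a b c : ℕ) : ℝ) ^ (1 : ℝ) := (Real.rpow_one _).symm
      _ ≤ ((rad a b c : ℕ) : ℝ) ^ M := Real.rpow_le_rpow_of_exponent_le hR1 hM1.le
      _ ≤ Cst * ((rad a b c : ℕ) : ℝ) ^ M := le_mul_of_one_le_left (by positivity) hCst1
  -- generic triple: a small `ψ`-independent `ψ ∈ 𝒯(a,b)` exists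
  have hψ : ∃ ψ : ℕ → ℤ, Pasten.IsAdapted ψ a b ∧ Pasten.wronskian ψ a b ≠ 0 ∧
      ∀ p : ℕ, (|ψ p| : ℝ) < (c : ℝ) ^ η := by
    by_contra hno
    exact hmem ⟨habc, hex, hno⟩
  obtain ⟨ψ, had, hW, hsmall⟩ := hψ
  have h11 : (a, b) ≠ (1, 1) := by
    intro h
    obtain ⟨rfl, rfl⟩ := Prod.mk.inj h
    have hc : c = 2 := by obtain ⟨-, -, hs, -⟩ := habc; omega
    exact hex (Or.inl ⟨rfl, Or.inr (hc ▸ Nat.prime_two)⟩)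
  have hsum : a + b = c := habc.2.2.1
  have hest : (c : ℝ) / Real.log c ≤ (rad a b c : ℝ) * (c : ℝ) ^ η / Real.log 2 := by
    have h := Pasten.abc_estimate_holds a b ψ ((c : ℝ) ^ η) (by rw [hsum]; exact habc) h11 had hW
      fun p => (hsmall p).le
    simpa only [hsum] using h
  have hx0 : (0 : ℝ) < c := by positivity
  have hx1 : (1 : ℝ) < c := by exact_mod_cast hc2
  have hlogc : 0 < Real.log c := Real.log_pos hx1
  obtain ⟨R, hR⟩ : ∃ R : ℝ, R = (rad a b c : ℝ) := ⟨_, rfl⟩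
  rw [← hR] at hR2 hR1 hRM1 hest ⊢
  have hR0 : 0 < R := by linarith
  -- `c ≤ R c^η log c / log 2 ≤ R K c^(η+δ)`
  have h1 : (c : ℝ) ≤ R * (c : ℝ) ^ η * Real.log c / Real.log 2 := by
    have h := (div_le_iff₀ hlogc).mp hest
    calc (c : ℝ) ≤ R * (c : ℝ) ^ η / Real.log 2 * Real.log c := h
      _ = _ := by ring
  have h2 : Real.log c ≤ (c : ℝ) ^ δ / δ := Real.log_le_rpow_div hx0.le hδ0
  have h3 : (c : ℝ) ≤ R * K * (c : ℝ) ^ (η + δ) := by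
    calc (c : ℝ) ≤ R * (c : ℝ) ^ η * Real.log c / Real.log 2 := h1
      _ ≤ R * (c : ℝ) ^ η * ((c : ℝ) ^ δ / δ) / Real.log 2 :=
          div_le_div_of_nonneg_right (mul_le_mul_of_nonneg_left h2 (by positivity)) hlog2.le
      _ = R * K * ((c : ℝ) ^ η * (c : ℝ) ^ δ) := by
          rw [hK]
          field_simp
      _ = R * K * (c : ℝ) ^ (η + δ) := by rw [← Real.rpow_add hx0]
  -- divide by `c^(η+δ)`: `c^(1/M) ≤ R K` since `1/M + (η + δ) = 1`
  have h4 : (c : ℝ) ^ (1 / M) ≤ R * K := by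
    have h3' : (c : ℝ) ^ (1 / M) * (c : ℝ) ^ (η + δ) ≤ R * K * (c : ℝ) ^ (η + δ) :=
      calc (c : ℝ) ^ (1 / M) * (c : ℝ) ^ (η + δ) = (c : ℝ) := by
            rw [← Real.rpow_add hx0, show 1 / M + (η + δ) = 1 by rw [hδ]; ring, Real.rpow_one]
        _ ≤ R * K * (c : ℝ) ^ (η + δ) := h3
    exact le_of_mul_le_mul_right h3' (Real.rpow_pos_of_pos hx0 _)
  -- `c = (c^(1/M))^M ≤ (R K)^M = K^M R^M ≤ Cst R^M`
  have h5 : (c : ℝ) ≤ (R * K) ^ M := by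
    have hcM : (c : ℝ) = ((c : ℝ) ^ (1 / M)) ^ M := by
      rw [← Real.rpow_mul hx0.le, one_div_mul_cancel hM0.ne', Real.rpow_one]
    rw [hcM]
    exact Real.rpow_le_rpow (by positivity) h4 hM0.le
  calc (c : ℝ) ≤ (R * K) ^ M := h5
    _ = K ^ M * R ^ M := by rw [Real.mul_rpow hR0.le hK0.le, mul_comm]
    _ ≤ Cst * R ^ M := mul_le_mul_of_nonneg_right (le_max_right _ _) (by positivity)

/-- Packaging: per-`η` Small Derivatives ⟹ Pasten's Conj. 1.2 `PastenWeakABC` (via `pastenWeakABC_of_polyABC`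
at `M = 1/(1−η) + 1`) — the per-`η` refinement of the tree's `pastenWeakABC_of_smallDerivatives`. [folklore] -/
theorem pastenWeakABC_of_smallDerivativesWith {η : ℝ} (hη0 : 0 < η) (hη1 : η < 1)
    (h : Pasten.SmallDerivativesConjectureWith η) : PastenWeakABC :=
  pastenWeakABC_of_polyABC (polyABC_of_smallDerivativesWith hη0 hη1 h (M := 1 / (1 - η) + 1) (by linarith))

/-- **Positioning (PROVED): the UNPRINTED all-exponents reading of the Small Derivatives Conjecture would
give abc.** If `SmallDerivativesConjectureWith η` held for every `0 < η < 1`, then `PolyABC K` for every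
`K > 1` (take `η = (1 − 1/K)/2`, so `1/(1−η) = 2K/(K+1) < K`), which is `ABC`
(`Summit.ABC.ABC.Theorems.abc_iff_polyABC`). Pasten prints only `∃ η < 1` (Conj. 3.9) and Lemma 4.1; the
hypothesis here is the harvester's extrapolation «SDC ∀η», NOT printed, NOT implied by abc (Thm. 4.5 gives
only `η > 3/4`), and plausibly false for small `η` (REF-B: `ω = 3` prime-power triples suggest `η ≥ 1/2`);
this theorem only records what that reading would be worth (rung A0), it asserts nothing.
[cite: Pasten2021, Lemma 4.1 and Conj. 3.9] -/
theorem abc_of_forall_smallDerivativesWith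
    (h : ∀ η : ℝ, 0 < η → η < 1 → Pasten.SmallDerivativesConjectureWith η) : _root_.ABC := by
  rw [Summit.ABC.ABC.Theorems.abc_iff_polyABC]
  intro K hK
  have hK0 : 0 < K := by linarith
  have hK1 : 1 / K < 1 := by rw [div_lt_one hK0]; exact hK
  have hKi : 0 < 1 / K := by positivity
  obtain ⟨η, hη⟩ : ∃ η : ℝ, η = (1 - 1 / K) / 2 := ⟨_, rfl⟩
  have hη0 : 0 < η := by rw [hη]; linarith
  have hη1 : η < 1 := by rw [hη]; linarith
  have hMη : 1 / (1 - η) < K := by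
    rw [div_lt_iff₀ (by linarith), hη]
    have : K * (1 - (1 - 1 / K) / 2) = (K + 1) / 2 := by
      field_simp
      ring
    rw [this]
    linarith
  exact polyABC_of_smallDerivativesWith hη0 hη1 (h η hη0 hη1) hMη

/-! ## §3 Currency bridge to the abc-ff cell's `PolyAbcWith` (appended 2026-08-27; dedup pointer of the
abc-ff referee REF-B, abc-harv STATUS 17:28:15Z) -/

/-- **Bridge (PROVED): the two poly-abc currencies of the ABC cells agree.**
`Summit.ABC.ABC.Theorems.PolyABC M` (`∃ C > 0, ∀ abc triples, c ≤ C·rad(abc)^M`, solo-ABC-blind file) ↔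
`Summit.ABC.FunctionField.PolyAbcWith M` (`∃ C, ∀ abc triples, c ≤ C·rad(abc)^M`, abc-ff transfer sheet):
a constant of either sign is replaced by `max C 1 > 0` (`rad^M ≥ 0`). Consequently the abc-ff cell's
`Summit.ABC.FunctionField.polyAbcWith_of_smallDerivativesWith` (`TransferSheetMason.lean`, p548194) and
`polyABC_of_smallDerivativesWith` of §2 are the SAME arrow (Pasten's Lemma 4.1 per `η`) in two
currencies — a content duplicate across cells, recorded here by this bridge rather than hidden; either
lemma now yields the other in one line. [folklore] -/
theorem polyABC_iff_polyAbcWith (M : ℝ) :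
    Summit.ABC.ABC.Theorems.PolyABC M ↔ Summit.ABC.FunctionField.PolyAbcWith M := by
  refine ⟨fun ⟨C, _, hC⟩ => ⟨C, hC⟩, fun ⟨C, hC⟩ => ⟨max C 1, lt_max_of_lt_right one_pos, ?_⟩⟩
  intro a b c habc
  calc (c : ℝ) ≤ C * ((rad a b c : ℕ) : ℝ) ^ M := hC a b c habc
    _ ≤ max C 1 * ((rad a b c : ℕ) : ℝ) ^ M :=
      mul_le_mul_of_nonneg_right (le_max_left _ _) (Real.rpow_nonneg (Nat.cast_nonneg _) _)

end Summit.ABC.Harvest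

end
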